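import Literature.GroupTheory.CombinatorialGroupTheory.PuncturedSurfaceGroupThreeChainBases
import HarnessLib

/-!
# The three subsurface groups of a chain degeneration as sub-basis closures of ONE free basis

Topic `Literature/GroupTheory/CombinatorialGroupTheory`; theorems only.  `Γ_{g,r} = ⟨a_i, b_i, c_j ∣
∏_i [a_i,b_i] · c_0 ⋯ c_{r−1}⟩` (`PuncturedSurfaceGroup g r`, [SemiAnbd] Example 2.10
[cite: MochizukiSemiAnbd2006, Ex. 2.10 p.31]).  Sequel of `PuncturedSurfaceGroupThreeChainBases.lean`
(abc-iut-f-164): for the three-component chain degeneration `C₀ —ν_A— C_mid —ν_B— C₁` (handles `i < g₀` /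
`g₀ ≤ i < g₁` / `i ≥ g₁`, cusps `j ≥ s₂` / `s₁ ≤ j < s₂` / `j < s₁`; node loops
`ε_A = (c_{s₂}⋯c_{r−1})∏_{i<g₀}[a_i,b_i]`, `η = (c_{s₁}⋯c_{r−1})∏_{i<g₁}[a_i,b_i]`) and a free basis
`B = (a_i, b_i, c_1, …, c_{s₁−1}, η, c_{s₁+1}, …, c_{s₂−1}, ε_A, c_{s₂+1}, …, c_{r−1})` of `Γ_{g,r}`:

* `closure_chainFirst_eq` — `⟨a_i,b_i (i<g₀), c_j (j≥s₂)⟩ = ⟨B(S₀)⟩`, `S₀ = {i<g₀} ∪ {j : s₂ ≤ j+1}`;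
* `closure_chainLast_eq` — `⟨a_i,b_i (i≥g₁), c_j (j<s₁), η⟩ = ⟨B(S₁)⟩`, `S₁ = {i≥g₁} ∪ {j : j+1 ≤ s₁}`;
* `closure_chainMid_eq` — `⟨a_i,b_i (g₀≤i<g₁), c_j (s₁≤j<s₂), ε_A, η⟩ = ⟨B(S_mid)⟩`,
  `S_mid = {g₀≤i<g₁} ∪ {j : s₁ ≤ j+1 ≤ s₂}`;

so that `S₀ ∩ S_mid = {slot of ε_A}`, `S_mid ∩ S₁ = {slot of η}`, `S₀ ∩ S₁ = ∅` — ONE basis carries all three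
subsurface groups and both node loops (input of free-factor malnormality / disjointness for [CombGC] Prop.
1.2 / 1.5 at three-component chain data).  Elementary combinatorial group theory (Lyndon–Schupp I.3);
nothing here concerns [IUTchIII].
-/

namespace Literature.GroupTheory.CombinatorialGroupTheory

namespace PuncturedSurfaceGroup

variable {g r : ℕ}

section Chain

variable {r' : ℕ} {g₀ g₁ s₁ s₂ : ℕ} {εA η : PuncturedSurfaceGroup g (r' + 1)}
  {B : FreeGroupBasis ((Fin g × Bool) ⊕ Fin r') (PuncturedSurfaceGroup g (r' + 1))}
  (hεA : εA = ((List.finRange (r' + 1)).map fun j : Fin (r' + 1) =>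
        if s₂ ≤ (j : ℕ) then c (g := g) j else 1).prod *
      ((List.finRange g).map fun i : Fin g => if (i : ℕ) < g₀ then
        a (r := r' + 1) i * b i * (a i)⁻¹ * (b i)⁻¹ else 1).prod)
  (hη : η = ((List.finRange (r' + 1)).map fun j : Fin (r' + 1) =>
        if s₁ ≤ (j : ℕ) then c (g := g) j else 1).prod *
      ((List.finRange g).map fun i : Fin g => if (i : ℕ) < g₁ then
        a (r := r' + 1) i * b i * (a i)⁻¹ * (b i)⁻¹ else 1).prod)
  (ha : ∀ i, B (Sum.inl (i, false)) = a i) (hb : ∀ i, B (Sum.inl (i, true)) = b i)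

/-! ### The three subsurface groups as sub-basis closures of one basis -/

variable (hc : ∀ j : Fin r', (j : ℕ) + 1 ≠ s₁ → (j : ℕ) + 1 ≠ s₂ → B (Sum.inr j) = c (Fin.succ j))
  (hA : ∀ h : s₂ - 1 < r', B (Sum.inr ⟨s₂ - 1, h⟩) = εA)
  (hB : ∀ h : s₁ - 1 < r', B (Sum.inr ⟨s₁ - 1, h⟩) = η)

include hc in
/-- A cusp `c_j` (`j ≥ 1`, `j ∉ {s₁, s₂}`) is the member of `B` at `j − 1`: membership in sub-basis closures.
[cite: MochizukiSemiAnbd2006, Ex. 2.10 p.31] -/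
theorem chainBasis_cusp_mem_closure {S : Set ((Fin g × Bool) ⊕ Fin r')} (j : Fin (r' + 1))
    (hj0 : (j : ℕ) ≠ 0) (hj1 : (j : ℕ) ≠ s₁) (hj2 : (j : ℕ) ≠ s₂)
    (hS : ∀ k : Fin r', (k : ℕ) + 1 = (j : ℕ) → Sum.inr k ∈ S) :
    c (g := g) j ∈ Subgroup.closure (B '' S) := by
  have e1 : B (Sum.inr (j.pred (fun h => hj0 (by rw [h]; rfl)))) = c j := by
    rw [hc _ (by rw [Fin.val_pred]; omega) (by rw [Fin.val_pred]; omega), Fin.succ_pred]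
  rw [← e1]
  exact Subgroup.subset_closure ⟨_, hS _ (by rw [Fin.val_pred]; omega), rfl⟩

include hεA ha hb hc hA in
/-- **The first component `C₀`**: for `1 ≤ s₁ < s₂ ≤ r'`, `⟨a_i, b_i (i<g₀), c_j (j ≥ s₂)⟩ = ⟨B(x) : x ∈ S₀⟩`,
`S₀ = {(i,·) : i < g₀} ∪ {j : s₂ ≤ j+1}` (`c_{s₂} = ε_A (∏_{i<g₀}[a_i,b_i])⁻¹ (c_{s₂+1}⋯c_{r'})⁻¹`).
[cite: MochizukiSemiAnbd2006, Ex. 2.10 p.31] -/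
theorem closure_chainFirst_eq (hs : s₁ < s₂) (hsr : s₂ ≤ r') :
    Subgroup.closure {x : PuncturedSurfaceGroup g (r' + 1) |
        (∃ i : Fin g, (i : ℕ) < g₀ ∧ (x = a i ∨ x = b i)) ∨ ∃ j : Fin (r' + 1), s₂ ≤ (j : ℕ) ∧ x = c j} =
      Subgroup.closure (B '' {x | Sum.elim (fun p : Fin g × Bool => (p.1 : ℕ) < g₀)
        (fun j : Fin r' => s₂ ≤ (j : ℕ) + 1) x}) := by
  classical
  set S₀ : Set ((Fin g × Bool) ⊕ Fin r') :=
    {x | Sum.elim (fun p : Fin g × Bool => (p.1 : ℕ) < g₀) (fun j : Fin r' => s₂ ≤ (j : ℕ) + 1) x} with hS₀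
  have hSl : ∀ p : Fin g × Bool, (Sum.inl p : (Fin g × Bool) ⊕ Fin r') ∈ S₀ ↔ (p.1 : ℕ) < g₀ :=
    fun _ => Iff.rfl
  have hSr : ∀ j : Fin r', (Sum.inr j : (Fin g × Bool) ⊕ Fin r') ∈ S₀ ↔ s₂ ≤ (j : ℕ) + 1 := fun _ => Iff.rfl
  have hs₂ : s₂ < r' + 1 := by omega
  have haR : ∀ i : Fin g, (i : ℕ) < g₀ → a (r := r' + 1) i ∈ Subgroup.closure (B '' S₀) := fun i hi =>
    Subgroup.subset_closure ⟨Sum.inl (i, false), (hSl _).mpr hi, ha i⟩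
  have hbR : ∀ i : Fin g, (i : ℕ) < g₀ → b (r := r' + 1) i ∈ Subgroup.closure (B '' S₀) := fun i hi =>
    Subgroup.subset_closure ⟨Sum.inl (i, true), (hSl _).mpr hi, hb i⟩
  have hAR : εA ∈ Subgroup.closure (B '' S₀) := by
    rw [← hA (by omega)]
    exact Subgroup.subset_closure ⟨_, (hSr _).mpr (by simp only; omega), rfl⟩
  have hcR : ∀ j : Fin (r' + 1), s₂ + 1 ≤ (j : ℕ) → c (g := g) j ∈ Subgroup.closure (B '' S₀) :=
    fun j hj => chainBasis_cusp_mem_closure hc j (by omega) (by omega) (by omega) fun k hk' =>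
      (hSr _).mpr (by omega)
  have hcs : c (g := g) ⟨s₂, hs₂⟩ ∈ Subgroup.closure (B '' S₀) := by
    have e : c (g := g) ⟨s₂, hs₂⟩ = εA *
        (((List.finRange (r' + 1)).map fun j : Fin (r' + 1) =>
            if s₂ + 1 ≤ (j : ℕ) then c (g := g) j else 1).prod *
          ((List.finRange g).map fun i : Fin g => if (i : ℕ) < g₀ then
            a (r := r' + 1) i * b i * (a i)⁻¹ * (b i)⁻¹ else 1).prod)⁻¹ := by
      rw [nodeLoop_eq_c_mul (g := g) g₀ s₂ hs₂ εA hεA, mul_inv_cancel_right]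
    rw [e]
    exact Subgroup.mul_mem _ hAR (Subgroup.inv_mem _ (Subgroup.mul_mem _
      (prod_map_finRange_ite_mem _ _ _ _ hcR) (comm_prod_ite_mem _ _ haR hbR)))
  apply le_antisymm
  · rw [Subgroup.closure_le]
    rintro x (⟨i, hi, rfl | rfl⟩ | ⟨j, hj, rfl⟩)
    · exact haR i hi
    · exact hbR i hi
    · by_cases hjs : (j : ℕ) = s₂
      · have : j = ⟨s₂, hs₂⟩ := Fin.ext hjs
        rw [this]; exact hcs
      · exact hcR j (by omega)
  · rw [Subgroup.closure_le]
    rintro _ ⟨y, hy, rfl⟩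
    rcases y with ⟨i, _ | _⟩ | j
    · exact Subgroup.subset_closure (Or.inl ⟨i, (hSl _).mp hy, Or.inl (ha i)⟩)
    · exact Subgroup.subset_closure (Or.inl ⟨i, (hSl _).mp hy, Or.inr (hb i)⟩)
    · have hj : s₂ ≤ (j : ℕ) + 1 := (hSr _).mp hy
      by_cases hjs : (j : ℕ) + 1 = s₂
      · have : j = ⟨s₂ - 1, by omega⟩ := Fin.ext (by simp only; omega)
        rw [this, hA (by omega), hεA]
        refine Subgroup.mul_mem _ (prod_map_finRange_ite_mem _ _ _ _ fun j hj =>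
            Subgroup.subset_closure (Or.inr ⟨j, hj, rfl⟩))
          (comm_prod_ite_mem _ _ (fun i hi => Subgroup.subset_closure (Or.inl ⟨i, hi, Or.inl rfl⟩))
            (fun i hi => Subgroup.subset_closure (Or.inl ⟨i, hi, Or.inr rfl⟩)))
      · rw [hc j (by omega) hjs]
        exact Subgroup.subset_closure (Or.inr ⟨Fin.succ j, by rw [Fin.val_succ]; omega, rfl⟩)

include hη ha hb hc hB in
/-- **The last component `C₁`**: for `1 ≤ s₁ < s₂ ≤ r'`, `⟨a_i, b_i (i ≥ g₁), c_j (j < s₁), η⟩ = ⟨B(x) : x ∈ S₁⟩`,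
`S₁ = {(i,·) : g₁ ≤ i} ∪ {j : j+1 ≤ s₁}` (`c_0` is recovered from `(∏_{i≥g₁}[a_i,b_i]) c_0⋯c_{s₁−1} η = 1`).
[cite: MochizukiSemiAnbd2006, Ex. 2.10 p.31] -/
theorem closure_chainLast_eq (hs1 : 1 ≤ s₁) (hs : s₁ < s₂) (hsr : s₂ ≤ r') :
    Subgroup.closure {x : PuncturedSurfaceGroup g (r' + 1) |
        (∃ i : Fin g, g₁ ≤ (i : ℕ) ∧ (x = a i ∨ x = b i)) ∨
          (∃ j : Fin (r' + 1), (j : ℕ) < s₁ ∧ x = c j) ∨ x = η} =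
      Subgroup.closure (B '' {x | Sum.elim (fun p : Fin g × Bool => g₁ ≤ (p.1 : ℕ))
        (fun j : Fin r' => (j : ℕ) + 1 ≤ s₁) x}) := by
  classical
  set S₁ : Set ((Fin g × Bool) ⊕ Fin r') :=
    {x | Sum.elim (fun p : Fin g × Bool => g₁ ≤ (p.1 : ℕ)) (fun j : Fin r' => (j : ℕ) + 1 ≤ s₁) x} with hS₁
  have hTl : ∀ p : Fin g × Bool, (Sum.inl p : (Fin g × Bool) ⊕ Fin r') ∈ S₁ ↔ g₁ ≤ (p.1 : ℕ) :=
    fun _ => Iff.rfl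
  have hTr : ∀ j : Fin r', (Sum.inr j : (Fin g × Bool) ⊕ Fin r') ∈ S₁ ↔ (j : ℕ) + 1 ≤ s₁ := fun _ => Iff.rfl
  have hr0 : 0 < r' + 1 := Nat.succ_pos r'
  have haT : ∀ i : Fin g, g₁ ≤ (i : ℕ) → a (r := r' + 1) i ∈ Subgroup.closure (B '' S₁) := fun i hi =>
    Subgroup.subset_closure ⟨Sum.inl (i, false), (hTl _).mpr hi, ha i⟩
  have hbT : ∀ i : Fin g, g₁ ≤ (i : ℕ) → b (r := r' + 1) i ∈ Subgroup.closure (B '' S₁) := fun i hi =>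
    Subgroup.subset_closure ⟨Sum.inl (i, true), (hTl _).mpr hi, hb i⟩
  have hηT : η ∈ Subgroup.closure (B '' S₁) := by
    rw [← hB (by omega)]
    exact Subgroup.subset_closure ⟨_, (hTr _).mpr (by simp only; omega), rfl⟩
  have hcT : ∀ j : Fin (r' + 1), 1 ≤ (j : ℕ) ∧ (j : ℕ) < s₁ → c (g := g) j ∈ Subgroup.closure (B '' S₁) :=
    fun j hj => chainBasis_cusp_mem_closure hc j (by omega) (by omega) (by omega) fun k hk' =>
      (hTr _).mpr (by omega)
  have hc0 : c (g := g) ⟨0, hr0⟩ ∈ Subgroup.closure (B '' S₁) := by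
    have hrel := nodeLoop_rel (g := g) (r := r' + 1) g₁ s₁ η hη
    rw [cusp_prod_lt_eq_c_zero_mul (g := g) s₁ (by omega) hr0] at hrel
    set Y := ((List.finRange g).map fun i : Fin g => if g₁ ≤ (i : ℕ) then
        a (r := r' + 1) i * b i * (a i)⁻¹ * (b i)⁻¹ else 1).prod with hY
    set Cp := ((List.finRange (r' + 1)).map fun j : Fin (r' + 1) =>
        if 1 ≤ (j : ℕ) ∧ (j : ℕ) < s₁ then c (g := g) j else 1).prod with hC
    have hc0eq : c (g := g) ⟨0, hr0⟩ = Y⁻¹ * (Cp * η)⁻¹ := by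
      have h1 : Y * (c (g := g) ⟨0, hr0⟩ * (Cp * η)) = 1 := by
        rw [← hrel]; simp only [mul_assoc]
      exact eq_mul_inv_of_mul_eq (eq_inv_of_mul_eq_one_right h1)
    rw [hc0eq]
    exact Subgroup.mul_mem _ (Subgroup.inv_mem _ (comm_prod_ite_mem _ _ haT hbT))
      (Subgroup.inv_mem _ (Subgroup.mul_mem _ (prod_map_finRange_ite_mem _ _ _ _ hcT) hηT))
  apply le_antisymm
  · rw [Subgroup.closure_le]
    rintro x (⟨i, hi, rfl | rfl⟩ | ⟨j, hj, rfl⟩ | rfl)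
    · exact haT i hi
    · exact hbT i hi
    · by_cases hj0 : (j : ℕ) = 0
      · have : j = ⟨0, hr0⟩ := Fin.ext hj0
        rw [this]; exact hc0
      · exact hcT j ⟨by omega, hj⟩
    · exact hηT
  · rw [Subgroup.closure_le]
    rintro _ ⟨y, hy, rfl⟩
    apply Subgroup.subset_closure
    rcases y with ⟨i, _ | _⟩ | j
    · exact Or.inl ⟨i, (hTl _).mp hy, Or.inl (ha i)⟩
    · exact Or.inl ⟨i, (hTl _).mp hy, Or.inr (hb i)⟩
    · have hj : (j : ℕ) + 1 ≤ s₁ := (hTr _).mp hy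
      by_cases hjs : (j : ℕ) + 1 = s₁
      · have : j = ⟨s₁ - 1, by omega⟩ := Fin.ext (by simp only; omega)
        rw [this, hB (by omega)]
        exact Or.inr (Or.inr rfl)
      · rw [hc j hjs (by omega)]
        exact Or.inr (Or.inl ⟨Fin.succ j, by rw [Fin.val_succ]; omega, rfl⟩)

include hεA hη ha hb hc hA hB in
/-- **The middle component `C_mid`**: for `g₀ ≤ g₁`, `1 ≤ s₁ < s₂ ≤ r'`,
`⟨a_i, b_i (g₀ ≤ i < g₁), c_j (s₁ ≤ j < s₂), ε_A, η⟩ = ⟨B(x) : x ∈ S_mid⟩`,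
`S_mid = {(i,·) : g₀ ≤ i < g₁} ∪ {j : s₁ ≤ j+1 ≤ s₂}` (the member `η` replaces
`c_{s₁} = η (∏_{g₀≤i<g₁}[a_i,b_i])⁻¹ ε_A⁻¹ (c_{s₁+1}⋯c_{s₂−1})⁻¹`). [cite: MochizukiSemiAnbd2006, Ex. 2.10 p.31] -/
theorem closure_chainMid_eq (hg : g₀ ≤ g₁) (hs1 : 1 ≤ s₁) (hs : s₁ < s₂) (hsr : s₂ ≤ r') :
    Subgroup.closure {x : PuncturedSurfaceGroup g (r' + 1) |
        (∃ i : Fin g, (g₀ ≤ (i : ℕ) ∧ (i : ℕ) < g₁) ∧ (x = a i ∨ x = b i)) ∨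
          (∃ j : Fin (r' + 1), (s₁ ≤ (j : ℕ) ∧ (j : ℕ) < s₂) ∧ x = c j) ∨ x = εA ∨ x = η} =
      Subgroup.closure (B '' {x | Sum.elim (fun p : Fin g × Bool => g₀ ≤ (p.1 : ℕ) ∧ (p.1 : ℕ) < g₁)
        (fun j : Fin r' => s₁ ≤ (j : ℕ) + 1 ∧ (j : ℕ) + 1 ≤ s₂) x}) := by
  classical
  set Sm : Set ((Fin g × Bool) ⊕ Fin r') :=
    {x | Sum.elim (fun p : Fin g × Bool => g₀ ≤ (p.1 : ℕ) ∧ (p.1 : ℕ) < g₁)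
      (fun j : Fin r' => s₁ ≤ (j : ℕ) + 1 ∧ (j : ℕ) + 1 ≤ s₂) x} with hSm
  have hMl : ∀ p : Fin g × Bool, (Sum.inl p : (Fin g × Bool) ⊕ Fin r') ∈ Sm ↔
      g₀ ≤ (p.1 : ℕ) ∧ (p.1 : ℕ) < g₁ := fun _ => Iff.rfl
  have hMr : ∀ j : Fin r', (Sum.inr j : (Fin g × Bool) ⊕ Fin r') ∈ Sm ↔
      s₁ ≤ (j : ℕ) + 1 ∧ (j : ℕ) + 1 ≤ s₂ := fun _ => Iff.rfl
  have hs₁ : s₁ < r' + 1 := by omega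
  have haM : ∀ i : Fin g, g₀ ≤ (i : ℕ) ∧ (i : ℕ) < g₁ →
      a (r := r' + 1) i ∈ Subgroup.closure (B '' Sm) := fun i hi =>
    Subgroup.subset_closure ⟨Sum.inl (i, false), (hMl _).mpr hi, ha i⟩
  have hbM : ∀ i : Fin g, g₀ ≤ (i : ℕ) ∧ (i : ℕ) < g₁ →
      b (r := r' + 1) i ∈ Subgroup.closure (B '' Sm) := fun i hi =>
    Subgroup.subset_closure ⟨Sum.inl (i, true), (hMl _).mpr hi, hb i⟩
  have hAM : εA ∈ Subgroup.closure (B '' Sm) := by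
    rw [← hA (by omega)]
    exact Subgroup.subset_closure ⟨_, (hMr _).mpr ⟨by simp only; omega, by simp only; omega⟩, rfl⟩
  have hBM : η ∈ Subgroup.closure (B '' Sm) := by
    rw [← hB (by omega)]
    exact Subgroup.subset_closure ⟨_, (hMr _).mpr ⟨by simp only; omega, by simp only; omega⟩, rfl⟩
  have hcM : ∀ j : Fin (r' + 1), s₁ + 1 ≤ (j : ℕ) ∧ (j : ℕ) < s₂ →
      c (g := g) j ∈ Subgroup.closure (B '' Sm) :=
    fun j hj => chainBasis_cusp_mem_closure hc j (by omega) (by omega) (by omega) fun k hk' =>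
      (hMr _).mpr ⟨by omega, by omega⟩
  have hcs : c (g := g) ⟨s₁, hs₁⟩ ∈ Subgroup.closure (B '' Sm) := by
    have e : c (g := g) ⟨s₁, hs₁⟩ = η *
        (((List.finRange (r' + 1)).map fun j : Fin (r' + 1) =>
            if s₁ + 1 ≤ (j : ℕ) ∧ (j : ℕ) < s₂ then c (g := g) j else 1).prod * εA *
          ((List.finRange g).map fun i : Fin g => if g₀ ≤ (i : ℕ) ∧ (i : ℕ) < g₁ then
            a (r := r' + 1) i * b i * (a i)⁻¹ * (b i)⁻¹ else 1).prod)⁻¹ := by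
      rw [secondLoop_eq_c_mul hεA hη hg hs hs₁, mul_inv_cancel_right]
    rw [e]
    exact Subgroup.mul_mem _ hBM (Subgroup.inv_mem _ (Subgroup.mul_mem _ (Subgroup.mul_mem _
      (prod_map_finRange_ite_mem _ _ _ _ hcM) hAM) (comm_prod_ite_mem _ _ haM hbM)))
  apply le_antisymm
  · rw [Subgroup.closure_le]
    rintro x (⟨i, hi, rfl | rfl⟩ | ⟨j, hj, rfl⟩ | rfl | rfl)
    · exact haM i hi
    · exact hbM i hi
    · by_cases hjs : (j : ℕ) = s₁
      · have : j = ⟨s₁, hs₁⟩ := Fin.ext hjs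
        rw [this]; exact hcs
      · exact hcM j ⟨by omega, hj.2⟩
    · exact hAM
    · exact hBM
  · rw [Subgroup.closure_le]
    rintro _ ⟨y, hy, rfl⟩
    apply Subgroup.subset_closure
    rcases y with ⟨i, _ | _⟩ | j
    · exact Or.inl ⟨i, (hMl _).mp hy, Or.inl (ha i)⟩
    · exact Or.inl ⟨i, (hMl _).mp hy, Or.inr (hb i)⟩
    · obtain ⟨hj1, hj2⟩ := (hMr _).mp hy
      by_cases hjs₁ : (j : ℕ) + 1 = s₁
      · have : j = ⟨s₁ - 1, by omega⟩ := Fin.ext (by simp only; omega)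
        rw [this, hB (by omega)]
        exact Or.inr (Or.inr (Or.inr rfl))
      · by_cases hjs₂ : (j : ℕ) + 1 = s₂
        · have : j = ⟨s₂ - 1, by omega⟩ := Fin.ext (by simp only; omega)
          rw [this, hA (by omega)]
          exact Or.inr (Or.inr (Or.inl rfl))
        · rw [hc j hjs₁ hjs₂]
          exact Or.inr (Or.inl ⟨Fin.succ j, by rw [Fin.val_succ]; omega, rfl⟩)

/-! ### The chain basis and its three cusp variants -/

include hεA hη in
/-- **The chain basis and its three cusp variants.**  For `g₀ ≤ g₁`, `2 ≤ s₁`, `s₁ + 2 ≤ s₂`, `s₂ + 1 ≤ r'`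
(each component carries at least two cusps) there are free bases `B, B₀, B₁, B₂` of `Γ_{g,r'+1}` with
`B = (a_i, b_i, c_1, …, c_{s₁−1}, η, c_{s₁+1}, …, c_{s₂−1}, ε_A, c_{s₂+1}, …, c_{r'})` and `B₀`, `B₁`, `B₂`
agreeing with `B` off ONE slot, where they carry the three cusps that are not members of `B`: `c_0` (slot of
`c_1`), `c_{s₁}` (slot of `c_{s₁+1}`), `c_{s₂}` (slot of `c_{s₂+1}`) — abc-iut-f-166's node-loop basis, the
Nielsen cusp moves of `PuncturedSurfaceGroupTwoComponentBases.lean`, and the two insertions above.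
[cite: LyndonSchupp2001, I.3 Prop 3.8] -/
theorem exists_chainBases (hg : g₀ ≤ g₁) (hs₁ : 2 ≤ s₁) (hs₁₂ : s₁ + 2 ≤ s₂) (hs₂ : s₂ + 1 ≤ r') :
    ∃ B B₀ B₁ B₂ : FreeGroupBasis ((Fin g × Bool) ⊕ Fin r') (PuncturedSurfaceGroup g (r' + 1)),
      (∀ i, B (Sum.inl (i, false)) = a i) ∧ (∀ i, B (Sum.inl (i, true)) = b i) ∧
      (∀ j : Fin r', (j : ℕ) + 1 ≠ s₁ → (j : ℕ) + 1 ≠ s₂ → B (Sum.inr j) = c (Fin.succ j)) ∧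
      (∀ h : s₂ - 1 < r', B (Sum.inr ⟨s₂ - 1, h⟩) = εA) ∧ (∀ h : s₁ - 1 < r', B (Sum.inr ⟨s₁ - 1, h⟩) = η) ∧
      (B₀ (Sum.inr ⟨0, by omega⟩) = c ⟨0, by omega⟩ ∧ ∀ x, x ≠ Sum.inr ⟨0, by omega⟩ → B₀ x = B x) ∧
      (B₁ (Sum.inr ⟨s₁, by omega⟩) = c ⟨s₁, by omega⟩ ∧ ∀ x, x ≠ Sum.inr ⟨s₁, by omega⟩ → B₁ x = B x) ∧
      (B₂ (Sum.inr ⟨s₂, by omega⟩) = c ⟨s₂, by omega⟩ ∧ ∀ x, x ≠ Sum.inr ⟨s₂, by omega⟩ → B₂ x = B x) := by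
  classical
  -- the node-loop basis of the loop `η` (parameters `(g₁, s₁)`), and of `ε_A` (parameters `(g₀, s₂)`)
  obtain ⟨bB, haB, hbB, hcB, hkB⟩ := exists_freeGroupBasis_nodeLoop g r' g₁ s₁ (by omega) (by omega) η hη
  have hkB' : ∀ h : s₁ - 1 < r', bB (Sum.inr ⟨s₁ - 1, h⟩) = η := fun _ => hkB
  obtain ⟨bA, haA, hbA, hcA, hkA⟩ := exists_freeGroupBasis_nodeLoop g r' g₀ s₂ (by omega) (by omega) εA hεA
  have hkA' : ∀ h : s₂ - 1 < r', bA (Sum.inr ⟨s₂ - 1, h⟩) = εA := fun _ => hkA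
  -- `B`: insert `ε_A` into `bB`
  have hBκ : bB (Sum.inr ⟨s₂ - 1, by omega⟩) = c ⟨s₂, by omega⟩ := by
    rw [hcB _ (by simp only; omega)]; congr 1; ext; simp only [Fin.val_succ]; omega
  obtain ⟨B, hBA, hB⟩ := exists_freeGroupBasis_insert_nodeLoop hεA haB hbB (by omega) (by omega) hBκ
    (fun j hj => hcB j (by omega))
  -- `B₀`: `c_0` first, then insert `ε_A`
  obtain ⟨b₅, hb₅κ, hb₅⟩ := exists_freeGroupBasis_nodeLoop_cusp_zero hη haB hbB hcB hkB' hs₁ (by omega)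
  have h5κ : b₅ (Sum.inr ⟨s₂ - 1, by omega⟩) = c ⟨s₂, by omega⟩ := by
    rw [hb₅ _ (by simp only [Ne, Sum.inr.injEq, Fin.ext_iff]; omega), hBκ]
  obtain ⟨B₀, hB₀A, hB₀⟩ := exists_freeGroupBasis_insert_nodeLoop hεA
    (fun i => by rw [hb₅ _ (by simp), haB]) (fun i => by rw [hb₅ _ (by simp), hbB]) (by omega) (by omega)
    h5κ (fun j hj => by
      rw [hb₅ _ (by simp only [Ne, Sum.inr.injEq, Fin.ext_iff]; omega), hcB j (by omega)])
  -- `B₁`: `c_{s₁}` first, then insert `ε_A`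
  obtain ⟨b₆, hb₆τ, hb₆⟩ := exists_freeGroupBasis_nodeLoop_cusp hη haB hbB hcB hkB' (by omega) (by omega)
  have h6κ : b₆ (Sum.inr ⟨s₂ - 1, by omega⟩) = c ⟨s₂, by omega⟩ := by
    rw [hb₆ _ (by simp only [Ne, Sum.inr.injEq, Fin.ext_iff]; omega), hBκ]
  obtain ⟨B₁, hB₁A, hB₁⟩ := exists_freeGroupBasis_insert_nodeLoop hεA
    (fun i => by rw [hb₆ _ (by simp), haB]) (fun i => by rw [hb₆ _ (by simp), hbB]) (by omega) (by omega)
    h6κ (fun j hj => by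
      rw [hb₆ _ (by simp only [Ne, Sum.inr.injEq, Fin.ext_iff]; omega), hcB j (by omega)])
  -- `B₂`: `c_{s₂}` in `bA`, then insert `η`
  obtain ⟨b₄, hb₄τ, hb₄⟩ := exists_freeGroupBasis_nodeLoop_cusp hεA haA hbA hcA hkA' (by omega) hs₂
  obtain ⟨B₂, hB₂B, hB₂⟩ := exists_freeGroupBasis_insert_secondLoop hεA hη
    (fun i => by rw [hb₄ _ (by simp), haA]) (fun i => by rw [hb₄ _ (by simp), hbA]) hg (by omega)
    (by omega) (by omega)
    (fun j hj1 hj2 => by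
      rw [hb₄ _ (by simp only [Ne, Sum.inr.injEq, Fin.ext_iff]; omega), hcA j (by omega)])
    (by rw [hb₄ _ (by simp only [Ne, Sum.inr.injEq, Fin.ext_iff]; omega)]; exact hkA)
  -- values of `B`
  have hBa : ∀ i, B (Sum.inl (i, false)) = a i := fun i => by rw [hB _ (by simp), haB]
  have hBb : ∀ i, B (Sum.inl (i, true)) = b i := fun i => by rw [hB _ (by simp), hbB]
  have hBc : ∀ j : Fin r', (j : ℕ) + 1 ≠ s₁ → (j : ℕ) + 1 ≠ s₂ → B (Sum.inr j) = c (Fin.succ j) :=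
    fun j hj1 hj2 => by
      rw [hB _ (by simp only [Ne, Sum.inr.injEq, Fin.ext_iff]; omega), hcB j hj1]
  have hBη : ∀ h : s₁ - 1 < r', B (Sum.inr ⟨s₁ - 1, h⟩) = η := fun h => by
    rw [hB _ (by simp only [Ne, Sum.inr.injEq, Fin.ext_iff]; omega), hkB]
  refine ⟨B, B₀, B₁, B₂, hBa, hBb, hBc, fun _ => hBA, hBη, ⟨?_, fun x hx => ?_⟩, ⟨?_, fun x hx => ?_⟩,
    ⟨?_, fun x hx => ?_⟩⟩
  · rw [hB₀ _ (by simp only [Ne, Sum.inr.injEq, Fin.ext_iff]; omega), hb₅κ]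
  · by_cases hxA : x = Sum.inr ⟨s₂ - 1, by omega⟩
    · subst hxA; rw [hB₀A, hBA]
    · rw [hB₀ x hxA, hb₅ x hx, hB x hxA]
  · rw [hB₁ _ (by simp only [Ne, Sum.inr.injEq, Fin.ext_iff]; omega), hb₆τ]
  · by_cases hxA : x = Sum.inr ⟨s₂ - 1, by omega⟩
    · subst hxA; rw [hB₁A, hBA]
    · rw [hB₁ x hxA, hb₆ x hx, hB x hxA]
  · rw [hB₂ _ (by simp only [Ne, Sum.inr.injEq, Fin.ext_iff]; omega), hb₄τ]
  · by_cases hxB : x = Sum.inr ⟨s₁ - 1, by omega⟩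
    · subst hxB; rw [hB₂B, hBη]
    · rw [hB₂ x hxB]
      by_cases hxA : x = Sum.inr ⟨s₂ - 1, by omega⟩
      · subst hxA
        rw [hb₄ _ (by simp only [Ne, Sum.inr.injEq, Fin.ext_iff]; omega), hkA, hBA]
      · rw [hb₄ x hx, hB x hxA]
        rcases x with ⟨i, _ | _⟩ | j
        · rw [haA, haB]
        · rw [hbA, hbB]
        · have hj1 : (j : ℕ) + 1 ≠ s₁ := fun h' => hxB (by
            simp only [Sum.inr.injEq, Fin.ext_iff]; omega)
          have hj2 : (j : ℕ) + 1 ≠ s₂ := fun h' => hxA (by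
            simp only [Sum.inr.injEq, Fin.ext_iff]; omega)
          rw [hcA j hj2, hcB j hj1]

end Chain

end PuncturedSurfaceGroup

end Literature.GroupTheory.CombinatorialGroupTheory
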